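import Literature.NumberTheory.EllipticCurves.KellerYin2024.CharacterSelmerGroups
import Summits.BirchSwinnertonDyer.Rank1Residual.X2.NonPrimitiveLambdaShift
import HarnessLib

/-!
# The `λ`-shift of the STRICT (`𝓕_Gr`) Keller–Yin / Castella–Grossi–Lee–Skinner Selmer duals of a
# GENERIC `p`-primary module along `S₁ ⊆ S₂`:
# `λ(𝔛^{S₂}_Gr) = λ(𝔛^{S₁}_Gr) + corank_{ℤ_p}(H¹_{𝓕_Gr^{S₂}}/H¹_{𝓕_Gr^{S₁}})` from `μ(𝔛^{S₂}_Gr) = 0`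

Cell `bsd-eis` (home `run/shared/lean/pub/bsd-eis/`), width seat `bsd-line-x2-p2` g8, crux 4 `BSDpOnCellC`
(stmt-BirchSwinnertonDyer-19034), line b1 v12 (skeleton of record 155e218d…, UNCHANGED). The STRICT twin
of seat k5-c2 g11's `Theorems/EisensteinPrimesUnrSelmerImprimitiveLambdaShift.lean` (the same algebra
for Keller–Yin's UNRAMIFIED groups `unrSelmer` / `GreenbergVatsal2000.DatumDualData`): here for the
Greenberg/STRICT groups `KellerYin2024.grSelmer κ M vbar S = H¹_{𝓕_Gr^S}(K_∞, M)` (strict at every place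
above `vbar`, no condition above the other primes over `p`, unramified off `S ∪ {w ∣ p}`) and their
Pontryagin-dual data `KellerYin2024.GrDualData κ M vbar S γ` — the currency of Castella–Grossi–Lee–
Skinner 2022 §1.2 (`𝔛_θ^S = H¹_{F_Gr}^S(K, M_θ)^∨`) in which the crux-4 chain at a NON-SPLIT
multiplicative Eisenstein prime is written (g6 p643997/p644365, g7 p654300: `λ(𝔛^{Sf}_f) = λ(Dsub.X) +
λ(Dquot.X)` for `Dsub`, `Dquot : GrDualData … ↑Sf γ`). WHY: CGLS Prop. 1.2.5's λ-clause
"`λ(𝔛_θ^S) = λ(𝔛_θ) + Σ_{w ∈ Σ, w ∤ p} λ(𝒫_w(θ))`" ([PWL-θ], the character-side `S`-relaxation the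
wall `stub_imprimitiveCount` needs after [ALG-imp]) splits into (a) the MODULE-THEORETIC half proved
here for any `M` — `λ(𝔛^{S₂}) = λ(𝔛^{S₁}) + corank_{ℤ_p}(Sel^{S₂}/Sel^{S₁})` — and (b) the VALUE of that
corank, `Σ_{w∈S} λ(𝒫_w(θ))`, which is the published input (CGLS (eq:sur2) = Pollack–Weston 2011
Prop. A.2 ∘ Lemma 1.1.1), typed separately at the character level.

HONEST FRAMING: tool theorems only (no definition, no named fact, no `sorry`), for a GENERIC discrete
`p`-primary `Γ_K`-module `M` with open stabilisers over ANY number field and ANY `ℤ_p`-extension, any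
place `vbar`, any `S₁ ⊆ S₂`; ported line by line from the `𝓕_nr` file (`unrSelmer ↦ grSelmer`,
`conjUnr ↦ conjGr`, `DatumDualData ↦ GrDualData`, `conjH1_mem_datumSelmer ↦
KellerYin2024.conjH1_mem_datumStrictSelmer`). Nothing here closes a stub of v12; BSD is proved for no
curve; no label or count moves.

## What

For a number field `K`, a prime `p`, a `ℤ_p`-extension `κ` with topological generator `γ`, a place
`vbar`, a discrete `Γ_K`-module `M` which is `p`-primary (`htor`) with open stabilisers (`hstab`),
and `S₁ ⊆ S₂`, write `Sel^{Sᵢ} = grSelmer κ M vbar Sᵢ` and let `X` (resp. `X₀`) be any strict dual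
datum of `Sel^{S₁}` (resp. `Sel^{S₂}`).

* §1 `toDual_smul`: the `Λ`-action of ANY `GrDualData` is the canonical one (`IsLocNil.smulFun` for
  `ψ = conj_γ − 1`), read through `toDual`.
* §2 `smulFun_comp_inclusion`: naturality of the canonical action along `Sel^{S₁} ↪ Sel^{S₂}`.
* §3 `exists_restrictDual`: the dual `r : X₀ ↠ X` of the inclusion is `Λ`-LINEAR and ONTO with
  kernel `{x | toDual x kills Sel^{S₁}}`; `nonempty_ker_addEquiv_characterModule`:
  `ker r ≃ Hom(Sel^{S₂}/Sel^{S₁}, ℚ/ℤ)`; `isPrimary_quotient`.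
* §4 **`lambdaInvariant_eq_add_zpCorank_of_muInvariant_eq_zero`**: if `X₀` is finitely generated
  and `Λ`-torsion with `μ(X₀) = 0` then `X` is finitely generated and torsion with `μ(X) = 0`, the
  `p`-torsion of `Sel^{S₂}/Sel^{S₁}` is finite, and **`λ(X₀) = λ(X) + corank_{ℤ_p}(Sel^{S₂}/Sel^{S₁})`**.
  NOT here: the VALUE `Σ_{w∈S} λ(𝒫_w(θ))` of that corank (CGLS Prop. 1.2.5's exact sequence (eq:sur2)
  via Pollack–Weston 2011 Prop. A.2 + CGLS/KY Lemma 1.1.1) — a published input, typed separately.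

References: Castella–Grossi–Lee–Skinner 2022 §1.2 Prop. 1.2.5 and proof (eq:sur1)–(eq:sur2)
(arXiv:2008.02571 Prop. 14); Greenberg–Vatsal 2000 §2 Cor. (2.3) and p. 21; Keller–Yin 2024 Prop. 1.2.5
(TeX L780–800); Greenberg LNM 1716 §1 p. 60.
-/

set_option linter.dupNamespace false
set_option autoImplicit false

noncomputable section

open scoped Classical AddSubgroup

open NumberField IsDedekindDomain Field
open Summit.BirchSwinnertonDyer.Rank1Residual
open Literature.NumberTheory.EllipticCurves Literature.NumberTheory.EllipticCurves.GreenbergSelmer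
  Literature.NumberTheory.EllipticCurves.GreenbergVatsal2000
  Literature.NumberTheory.EllipticCurves.IwasawaDual
  Literature.NumberTheory.EllipticCurves.KellerYin2024
  Literature.NumberTheory.GaloisRepresentations

universe u

namespace Summit.BirchSwinnertonDyer.BirchSwinnertonDyer.Theorems.GrSelmerImprimitiveLambdaShift

variable {K : Type u} [Field K] [NumberField K] {p : ℕ} [Fact p.Prime] (κ : ZpExtension K p)
  {M : Type u} [AddCommGroup M] [DistribMulAction (absoluteGaloisGroup K) M] [TopologicalSpace M]
  [DiscreteTopology M] (vbar : HeightOneSpectrum (𝓞 K))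

/-! ## §0. Plumbing: `conjGr` on classes, powers, the inclusion -/

/-- Unfolding `conjGr` on the underlying class (definitional; the Literature lemma is private).
[folklore] -/
theorem coe_conjGr_apply (S₀ : Set (HeightOneSpectrum (𝓞 K))) (γ : absoluteGaloisGroup K)
    (s : grSelmer κ M vbar S₀) :
    ((conjGr κ M vbar S₀ γ s : grSelmer κ M vbar S₀) : subgroupH1 κ.kerSubgroup M) =
      conjH1 κ.kerSubgroup M γ s :=
  rfl

/-- The inclusion `Sel^{S₁} ↪ Sel^{S₂}` intertwines `conj_γ`. [folklore] -/
theorem inclusion_conjGr {S₁ S₂ : Set (HeightOneSpectrum (𝓞 K))} (h12 : S₁ ⊆ S₂)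
    (γ : absoluteGaloisGroup K) (s : grSelmer κ M vbar S₁) :
    AddSubgroup.inclusion (grSelmer_mono κ M vbar h12) (conjGr κ M vbar S₁ γ s) =
      conjGr κ M vbar S₂ γ (AddSubgroup.inclusion (grSelmer_mono κ M vbar h12) s) :=
  Subtype.ext (by
    rw [AddSubgroup.coe_inclusion, coe_conjGr_apply, coe_conjGr_apply, AddSubgroup.coe_inclusion])

/-- The inclusion intertwines the powers of `ψ = conj_γ − 1`. [folklore] -/
theorem inclusion_conj_sub_one_pow_apply {S₁ S₂ : Set (HeightOneSpectrum (𝓞 K))} (h12 : S₁ ⊆ S₂)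
    (γ : absoluteGaloisGroup K) (i : ℕ) (s : grSelmer κ M vbar S₁) :
    AddSubgroup.inclusion (grSelmer_mono κ M vbar h12) (((conjGr κ M vbar S₁ γ - 1) ^ i) s) =
      ((conjGr κ M vbar S₂ γ - 1) ^ i) (AddSubgroup.inclusion (grSelmer_mono κ M vbar h12) s) := by
  induction i generalizing s with
  | zero => rw [pow_zero, pow_zero, AddMonoid.End.one_apply, AddMonoid.End.one_apply]
  | succ i ih =>
    rw [pow_succ, pow_succ, AddMonoid.End.coe_mul, AddMonoid.End.coe_mul, Function.comp_apply,
      Function.comp_apply, ih, IwasawaDual.End_sub_apply, IwasawaDual.End_sub_apply,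
      AddMonoid.End.one_apply, AddMonoid.End.one_apply, map_sub, inclusion_conjGr κ vbar h12]

/-! ## §1. The `Λ`-action of ANY strict dual datum of `H¹_{𝓕_Gr^S}(K_∞, M)` is forced -/

section Forced

variable {κ vbar} {γ : absoluteGaloisGroup K} {S₀ : Set (HeightOneSpectrum (𝓞 K))}

/-- Induction carrier for `toDual_smul` (strict twin of `UnrSelmerImprimitiveLambdaShift.toDual_smul_apply_of_pow_apply_eq_zero`,
itself a port of b2b `Iwasawa.DatumDualData.toDual_smul_apply_of_pow_apply_eq_zero`): on classes killed by `ψ^N`,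
`ψ = conj_γ − 1`, the action of any `GrDualData` read through `toDual` is the canonical finite sum `IsLocNil.smulFun`. [cite: GreenbergLNM1716, §1 (after Conj. 1.3)] -/
theorem toDual_smul_apply_of_pow_apply_eq_zero (htor : ∀ m : M, ∃ k : ℕ, p ^ k • m = 0)
    (hstab : ∀ m : M, IsOpen (MulAction.stabilizer (absoluteGaloisGroup K) m : Set (absoluteGaloisGroup K)))
    (hγ : κ.IsTopGenerator γ)
    (D : GrDualData κ M vbar S₀ γ) (N : ℕ) :
    ∀ (s : grSelmer κ M vbar S₀), ((conjGr κ M vbar S₀ γ - 1) ^ N) s = 0 →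
      ∀ (f : IwasawaAlgebra p) (x : D.X),
        D.toDual (f • x) s = (isLocNil_conjGr_sub_one κ vbar S₀ htor hstab hγ).smulFun f (D.toDual x) s := by
  set h := isLocNil_conjGr_sub_one κ vbar S₀ htor hstab hγ
  set ψ : AddMonoid.End (grSelmer κ M vbar S₀) := conjGr κ M vbar S₀ γ - 1 with hψ
  induction N with
  | zero =>
    intro s hs f x
    rw [pow_zero, AddMonoid.End.one_apply] at hs
    rw [hs, map_zero, map_zero]
  | succ N ih =>
    intro s hs f x
    obtain ⟨k, hk⟩ := h.torsion s
    have hψs : (ψ ^ N) (ψ s) = 0 := by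
      rwa [pow_succ, AddMonoid.End.coe_mul, Function.comp_apply] at hs
    have hψeval : ∀ y : D.X, D.toDual y (ψ s) =
        D.toDual y (conjGr κ M vbar S₀ γ s) - D.toDual y s := fun y ↦ by
      rw [hψ, IwasawaDual.End_sub_apply, AddMonoid.End.one_apply, map_sub]
    obtain ⟨g, a, hf⟩ : ∃ (g : IwasawaAlgebra p) (a : ℤ_[p]), f = PowerSeries.X * g + PowerSeries.C a :=
      ⟨_, _, PowerSeries.eq_X_mul_shift_add_const f⟩
    have lhs : D.toDual (f • x) s =
        D.toDual (g • x) (ψ s) + (PadicInt.toZModPow k a).val • D.toDual x s := by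
      conv_lhs => rw [hf]
      rw [add_smul, mul_smul, map_add, AddMonoidHom.add_apply, D.toDual_T_smul,
        D.toDual_C_smul a x s k hk, hψeval]
    have rhs : h.smulFun f (D.toDual x) s =
        h.smulFun g (D.toDual x) (ψ s) + (PadicInt.toZModPow k a).val • D.toDual x s := by
      conv_lhs => rw [hf]
      rw [h.smulFun_add_left, h.smulFun_mul_left, AddMonoidHom.add_apply, h.smulFun_X_apply,
        h.smulFun_C_apply a (D.toDual x) hk]
    exact lhs.trans ((congrArg (· + (PadicInt.toZModPow k a).val • D.toDual x s)
      (ih (ψ s) hψs g x)).trans rhs.symm)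

/-- **The `Λ`-action of a `GrDualData` of `H¹_{𝓕_Gr^S}(K_∞, M)` is forced** (`γ` a topological
generator, `M` `p`-primary with open stabilisers): `toDual (f • x) = f ⋆ toDual x` for the canonical
action attached to `ψ = conj_γ − 1` (`isLocNil_conjGr_sub_one`). [cite: GreenbergLNM1716, §1 (after Conj. 1.3)] -/
theorem toDual_smul (htor : ∀ m : M, ∃ k : ℕ, p ^ k • m = 0)
    (hstab : ∀ m : M, IsOpen (MulAction.stabilizer (absoluteGaloisGroup K) m : Set (absoluteGaloisGroup K)))
    (hγ : κ.IsTopGenerator γ)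
    (D : GrDualData κ M vbar S₀ γ) (f : IwasawaAlgebra p)
    (x : D.X) :
    D.toDual (f • x) = (isLocNil_conjGr_sub_one κ vbar S₀ htor hstab hγ).smulFun f (D.toDual x) := by
  ext s
  obtain ⟨N, hN⟩ := (isLocNil_conjGr_sub_one κ vbar S₀ htor hstab hγ).nil s
  exact toDual_smul_apply_of_pow_apply_eq_zero htor hstab hγ D N s hN f x

end Forced

/-! ## §2. Naturality of the canonical action along `Sel^{S₁} ↪ Sel^{S₂}` -/

/-- **Naturality of the canonical `Λ`-action along `H¹_{𝓕_Gr^{S₁}} ↪ H¹_{𝓕_Gr^{S₂}}`**: restricting a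
character of `Sel^{S₂}` to `Sel^{S₁}` commutes with `f ⋆ ·`. [cite: GreenbergLNM1716, §1 (after Conj. 1.3)] -/
theorem smulFun_comp_inclusion (htor : ∀ m : M, ∃ k : ℕ, p ^ k • m = 0)
    (hstab : ∀ m : M, IsOpen (MulAction.stabilizer (absoluteGaloisGroup K) m : Set (absoluteGaloisGroup K)))
    {γ : absoluteGaloisGroup K} (hγ : κ.IsTopGenerator γ) {S₁ S₂ : Set (HeightOneSpectrum (𝓞 K))}
    (h12 : S₁ ⊆ S₂) (f : IwasawaAlgebra p) (x : grSelmer κ M vbar S₂ →+ AddCircle (1 : ℚ)) :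
    ((isLocNil_conjGr_sub_one κ vbar S₂ htor hstab hγ).smulFun f x).comp
        (AddSubgroup.inclusion (grSelmer_mono κ M vbar h12)) =
      (isLocNil_conjGr_sub_one κ vbar S₁ htor hstab hγ).smulFun f
        (x.comp (AddSubgroup.inclusion (grSelmer_mono κ M vbar h12))) := by
  set h₂ := isLocNil_conjGr_sub_one κ vbar S₂ htor hstab hγ
  set h₁ := isLocNil_conjGr_sub_one κ vbar S₁ htor hstab hγ
  set ι := AddSubgroup.inclusion (grSelmer_mono κ M vbar h12) with hι
  ext s
  obtain ⟨N, hN⟩ := h₁.nil s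
  obtain ⟨k, hk⟩ := h₁.torsion s
  have hN₂ : ((conjGr κ M vbar S₂ γ - 1) ^ N) (ι s) = 0 := by
    rw [hι, ← inclusion_conj_sub_one_pow_apply κ vbar h12 γ N s, hN, map_zero]
  have hk₂ : p ^ k • ι s = 0 := by rw [← map_nsmul, hk, map_zero]
  rw [AddMonoidHom.comp_apply, h₂.smulFun_apply f x hN₂ hk₂, h₁.smulFun_apply f _ hN hk,
    IwasawaDual.evalT_def, IwasawaDual.evalT_def]
  refine Finset.sum_congr rfl fun i _ ↦ ?_
  rw [AddMonoidHom.comp_apply, hι, inclusion_conj_sub_one_pow_apply κ vbar h12 γ i s]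

/-! ## §3. The dual `r : X₀ ↠ X` of `Sel^{S₁} ↪ Sel^{S₂}`: `Λ`-linear, onto, kernel -/

/-- **The Pontryagin dual `X₀ → X` of `H¹_{𝓕_Gr^{S₁}} ↪ H¹_{𝓕_Gr^{S₂}}` exists as a `Λ`-LINEAR
SURJECTION** with kernel `{x | toDual x kills Sel^{S₁}}`, for ANY two dual data (both actions are
the canonical one by `toDual_smul`, natural along the inclusion by `smulFun_comp_inclusion`; onto
because characters of a subgroup extend, `ℚ/ℤ` being injective —
`CharacterModule.dual_surjective_of_injective`). Existence form, no definition. CGLS Prop. 1.2.5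
(eq:sur2) / KY Prop. 1.2.5 (eq. Gr to imp): the dual of `0 → H¹_{𝓕_Gr} → H¹_{𝓕_Gr^S}`.
[cite: GreenbergVatsal2000, §2 Cor. (2.3) (arXiv:math/9906215 pp. 20–21)]
[cite: CastellaGrossiLeeSkinner2022, Prop. 1.2.5 proof (eq:sur2) (arXiv:2008.02571 Prop. 14)] -/
theorem exists_restrictDual (htor : ∀ m : M, ∃ k : ℕ, p ^ k • m = 0)
    (hstab : ∀ m : M, IsOpen (MulAction.stabilizer (absoluteGaloisGroup K) m : Set (absoluteGaloisGroup K)))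
    {γ : absoluteGaloisGroup K} (hγ : κ.IsTopGenerator γ) {S₁ S₂ : Set (HeightOneSpectrum (𝓞 K))}
    (h12 : S₁ ⊆ S₂)
    (X : GrDualData κ M vbar S₁ γ)
    (X₀ : GrDualData κ M vbar S₂ γ) :
    ∃ r : X₀.X →ₗ[IwasawaAlgebra p] X.X,
      (∀ x : X₀.X, X.toDual (r x) = (X₀.toDual x).comp (AddSubgroup.inclusion
        (grSelmer_mono κ M vbar h12))) ∧
      Function.Surjective r ∧
      ∀ x : X₀.X, r x = 0 ↔ ∀ s : grSelmer κ M vbar S₁,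
        X₀.toDual x (AddSubgroup.inclusion (grSelmer_mono κ M vbar h12) s) = 0 := by
  set ι := AddSubgroup.inclusion (grSelmer_mono κ M vbar h12) with hι
  let e := AddEquiv.ofBijective X.toDual X.bijective
  have key : ∀ y, X.toDual (e.symm y) = y := fun y ↦ e.apply_symm_apply y
  let r : X₀.X →ₗ[IwasawaAlgebra p] X.X :=
    { toFun := fun x ↦ e.symm ((X₀.toDual x).comp ι)
      map_add' := fun x y ↦ by rw [← map_add, map_add, AddMonoidHom.add_comp]
      map_smul' := fun f x ↦ by
        apply X.bijective.1
        rw [RingHom.id_apply, toDual_smul htor hstab hγ X, key, key, toDual_smul htor hstab hγ X₀, hι,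
          smulFun_comp_inclusion κ vbar htor hstab hγ h12] }
  have hr : ∀ x, X.toDual (r x) = (X₀.toDual x).comp ι := fun x ↦ key _
  refine ⟨r, hr, fun y ↦ ?_, fun x ↦ ?_⟩
  · -- surjective: extend the character `X.toDual y` of `Sel^{S₁}` to `Sel^{S₂}`
    obtain ⟨χ', hχ'⟩ := CharacterModule.dual_surjective_of_injective ι.toIntLinearMap
      (AddSubgroup.inclusion_injective (grSelmer_mono κ M vbar h12)) (X.toDual y)
    obtain ⟨x, hx⟩ := X₀.bijective.2 χ'
    refine ⟨x, X.bijective.1 ?_⟩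
    rw [hr, hx]
    refine AddMonoidHom.ext fun s ↦ ?_
    have hs := DFunLike.congr_fun hχ' s
    rw [CharacterModule.dual_apply] at hs
    rw [AddMonoidHom.comp_apply]
    exact hs
  · -- kernel
    rw [← (injective_iff_map_eq_zero' _).1 X.bijective.1 (r x), hr]
    constructor
    · intro h s
      rw [← AddMonoidHom.comp_apply, h, AddMonoidHom.zero_apply]
    · intro h
      ext s
      rw [AddMonoidHom.comp_apply, h s, AddMonoidHom.zero_apply]

/-- **`ker r ≃ Hom(Sel^{S₂}/Sel^{S₁}, ℚ/ℤ)`** for the dual restriction `r : X₀ ↠ X` (any map with the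
kernel description of `exists_restrictDual`): a character of `Sel^{S₂}` vanishing on `Sel^{S₁}` is a
character of the quotient and conversely (`QuotientAddGroup.lift`). Port of b2b
`X2.NonPrimitiveLambdaShift.nonempty_ker_addEquiv_characterModule` to a generic module.
[cite: GreenbergVatsal2000, §2 Cor. (2.3) (arXiv:math/9906215 pp. 20–21)] -/
theorem nonempty_ker_addEquiv_characterModule {γ : absoluteGaloisGroup K}
    {S₁ S₂ : Set (HeightOneSpectrum (𝓞 K))} (h12 : S₁ ⊆ S₂)
    (X₀ : GrDualData κ M vbar S₂ γ)
    {Y : Type*} [AddCommGroup Y] [Module (IwasawaAlgebra p) Y] (r : X₀.X →ₗ[IwasawaAlgebra p] Y)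
    (hrker : ∀ x : X₀.X, r x = 0 ↔ ∀ s : grSelmer κ M vbar S₁,
      X₀.toDual x (AddSubgroup.inclusion (grSelmer_mono κ M vbar h12) s) = 0) :
    Nonempty (LinearMap.ker r ≃+
      CharacterModule (↥(grSelmer κ M vbar S₂) ⧸
        (grSelmer κ M vbar S₁).addSubgroupOf (grSelmer κ M vbar S₂))) := by
  set SS := grSelmer κ M vbar S₂ with hSS
  set S := grSelmer κ M vbar S₁ with hS
  have hle : S ≤ SS := grSelmer_mono κ M vbar h12
  set N : AddSubgroup SS := S.addSubgroupOf SS with hN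
  have hNmem : ∀ s : SS, s ∈ N ↔ (s : subgroupH1 κ.kerSubgroup M) ∈ S := fun s ↦
    AddSubgroup.mem_addSubgroupOf
  let e₀ := AddEquiv.ofBijective X₀.toDual X₀.bijective
  have key : ∀ χ, X₀.toDual (e₀.symm χ) = χ := fun χ ↦ e₀.apply_symm_apply χ
  have hmk : ∀ s : S, QuotientAddGroup.mk' N (AddSubgroup.inclusion hle s) = 0 := fun s ↦ by
    rw [QuotientAddGroup.mk'_apply, QuotientAddGroup.eq_zero_iff, hNmem, AddSubgroup.coe_inclusion]
    exact s.2
  have hmem : ∀ χ : CharacterModule (SS ⧸ N),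
      e₀.symm (AddMonoidHom.comp χ (QuotientAddGroup.mk' N)) ∈ LinearMap.ker r := fun χ ↦ by
    rw [LinearMap.mem_ker, hrker]
    intro s
    rw [key, AddMonoidHom.comp_apply]
    exact (congrArg χ (hmk s)).trans (map_zero χ)
  let g : CharacterModule (SS ⧸ N) → LinearMap.ker r := fun χ ↦ ⟨_, hmem χ⟩
  have hg0 : g 0 = 0 := Subtype.ext (by
    change e₀.symm _ = 0
    rw [show AddMonoidHom.comp (0 : CharacterModule (SS ⧸ N)) (QuotientAddGroup.mk' N) = 0 from
      AddMonoidHom.ext fun _ ↦ rfl, map_zero])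
  have hgadd : ∀ χ χ', g (χ + χ') = g χ + g χ' := fun χ χ' ↦ Subtype.ext (by
    change e₀.symm _ = e₀.symm _ + e₀.symm _
    rw [← map_add]
    exact congrArg e₀.symm (AddMonoidHom.ext fun _ ↦ rfl))
  let g' : CharacterModule (SS ⧸ N) →+ LinearMap.ker r :=
    { toFun := g, map_zero' := hg0, map_add' := hgadd }
  have hgval : ∀ χ : CharacterModule (SS ⧸ N), X₀.toDual ((g' χ : LinearMap.ker r) : X₀.X) =
      AddMonoidHom.comp χ (QuotientAddGroup.mk' N) := fun χ ↦ key _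
  have hginj : Function.Injective g' := by
    intro χ χ' h
    have h1 : X₀.toDual ((g' χ : LinearMap.ker r) : X₀.X) = X₀.toDual ((g' χ' : LinearMap.ker r) : X₀.X) := by
      rw [h]
    rw [hgval, hgval] at h1
    refine AddMonoidHom.ext fun q ↦ ?_
    obtain ⟨s, rfl⟩ := QuotientAddGroup.mk'_surjective N q
    exact DFunLike.congr_fun h1 s
  have hgsurj : Function.Surjective g' := by
    rintro ⟨y, hy⟩
    have hkill : N ≤ (X₀.toDual y).ker := fun n hn ↦ by
      rw [AddMonoidHom.mem_ker]
      have h := (hrker y).1 (LinearMap.mem_ker.1 hy) ⟨(n : subgroupH1 κ.kerSubgroup M), (hNmem n).1 hn⟩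
      have e : AddSubgroup.inclusion hle ⟨(n : subgroupH1 κ.kerSubgroup M), (hNmem n).1 hn⟩ = n :=
        Subtype.ext (AddSubgroup.coe_inclusion _ _)
      rwa [e] at h
    refine ⟨QuotientAddGroup.lift N (X₀.toDual y) hkill, Subtype.ext ?_⟩
    change e₀.symm (AddMonoidHom.comp (QuotientAddGroup.lift N (X₀.toDual y) hkill)
      (QuotientAddGroup.mk' N)) = y
    apply X₀.bijective.1
    rw [key]
    exact AddMonoidHom.ext fun s ↦ QuotientAddGroup.lift_mk' N hkill s
  exact ⟨(AddEquiv.ofBijective g' ⟨hginj, hgsurj⟩).symm⟩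

/-- `Sel^{S₂}/Sel^{S₁}` is `p`-primary (classes of `H¹(K_∞, M)` are killed by powers of `p` for `M`
`p`-primary: `GreenbergSelmer.exists_pow_smul_subgroupH1_eq_zero`). [cite: GreenbergLNM1716, §1 p. 60] -/
theorem isPrimary_quotient (htor : ∀ m : M, ∃ k : ℕ, p ^ k • m = 0)
    {S₁ S₂ : Set (HeightOneSpectrum (𝓞 K))}
    (q : ↥(grSelmer κ M vbar S₂) ⧸ (grSelmer κ M vbar S₁).addSubgroupOf (grSelmer κ M vbar S₂)) :
    ∃ n : ℕ, p ^ n • q = 0 := by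
  induction q using QuotientAddGroup.induction_on with
  | H s =>
    obtain ⟨n, hn⟩ := GreenbergSelmer.exists_pow_smul_subgroupH1_eq_zero κ M htor
      (s : subgroupH1 κ.kerSubgroup M)
    refine ⟨n, ?_⟩
    have hs : p ^ n • s = 0 := Subtype.ext (by rw [AddSubgroupClass.coe_nsmul]; exact hn)
    rw [← QuotientAddGroup.mk_nsmul, hs, QuotientAddGroup.mk_zero]

/-! ## §4. The `λ`-shift from `μ(X₀) = 0` -/

/-- **`λ(𝔛^{S₂}) = λ(𝔛^{S₁}) + corank_{ℤ_p}(H¹_{𝓕_Gr^{S₂}}/H¹_{𝓕_Gr^{S₁}})` when `μ(𝔛^{S₂}) = 0`**, for ANY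
dual data `X₀` of `H¹_{𝓕_Gr^{S₂}}(K_∞, M)` and `X` of `H¹_{𝓕_Gr^{S₁}}(K_∞, M)` (`S₁ ⊆ S₂`, `M`
`p`-primary with open stabilisers, `γ` a topological generator): if `X₀` is finitely generated and
`Λ`-torsion with `μ(X₀) = 0` then (i) `X` is finitely generated and `Λ`-torsion with `μ(X) = 0`
(a quotient of `X₀` by the dual restriction `r`; `μ` additive), (ii) the `p`-torsion of
`Sel^{S₂}/Sel^{S₁}` is finite, and (iii) `λ(X₀) = λ(X) + corank_{ℤ_p}(Sel^{S₂}/Sel^{S₁})`: `λ` is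
additive along `r` (`X2.DualRestrictionInvariants`) and `ker r ≅ Hom(Sel^{S₂}/Sel^{S₁}, ℚ/ℤ)` is
finitely generated torsion with `μ(ker r) ≤ μ(X₀) = 0`, whence `λ(ker r) = corank_{ℤ_p}(Sel^{S₂}/Sel^{S₁})`
(`X2.NonPrimitiveSelmerCorank`; GV p. 21). The module-theoretic half of CGLS Prop. 1.2.5's
"`λ(𝔛_θ^S) = λ(𝔛_θ) + Σ_{w ∈ Σ, w ∤ p} λ(𝒫_w(θ))`" (STRICT groups; KY Prop. 1.2.5 is the `𝓕_nr` twin);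
the other half (the corank equals `Σ λ𝒫_w(θ)`, (eq:sur2) = Pollack–Weston A.2 ∘ Lemma 1.1.1) is a
published input typed separately.
[cite: GreenbergVatsal2000, §2 Cor. (2.3) and p. 21 (arXiv:math/9906215 pp. 20–21)]
[cite: CastellaGrossiLeeSkinner2022, Prop. 1.2.5 and proof (eq:sur1)–(eq:sur2) (arXiv:2008.02571 Prop. 14; Invent. Math. 227 (2022))]
[cite: KellerYin2024, Prop. 1.2.5 (arXiv:2402.12781v2 TeX L780–800) (the 𝓕_nr twin)] -/
theorem lambdaInvariant_eq_add_zpCorank_of_muInvariant_eq_zero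
    (htor : ∀ m : M, ∃ k : ℕ, p ^ k • m = 0)
    (hstab : ∀ m : M, IsOpen (MulAction.stabilizer (absoluteGaloisGroup K) m : Set (absoluteGaloisGroup K)))
    {γ : absoluteGaloisGroup K} (hγ : κ.IsTopGenerator γ) {S₁ S₂ : Set (HeightOneSpectrum (𝓞 K))}
    (h12 : S₁ ⊆ S₂)
    (X₀ : GrDualData κ M vbar S₂ γ)
    [Module.Finite (IwasawaAlgebra p) X₀.X]
    (htor₀ : Module.IsTorsion (IwasawaAlgebra p) X₀.X) (hμ : muInvariant p X₀.X = 0)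
    (X : GrDualData κ M vbar S₁ γ) :
    Module.Finite (IwasawaAlgebra p) X.X ∧ Module.IsTorsion (IwasawaAlgebra p) X.X ∧
      muInvariant p X.X = 0 ∧
      Finite ((↥(grSelmer κ M vbar S₂) ⧸
        (grSelmer κ M vbar S₁).addSubgroupOf (grSelmer κ M vbar S₂))[(p : ℤ)]) ∧
      lambdaInvariant p X₀.X = lambdaInvariant p X.X +
        zpCorank (↥(grSelmer κ M vbar S₂) ⧸
          (grSelmer κ M vbar S₁).addSubgroupOf (grSelmer κ M vbar S₂)) p := by
  obtain ⟨r, -, hsurj, hker⟩ := exists_restrictDual κ vbar htor hstab hγ h12 X X₀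
  obtain ⟨Ψ⟩ := nonempty_ker_addEquiv_characterModule κ vbar h12 X₀ r hker
  -- (i) the quotient `X`
  haveI hfg : Module.Finite (IwasawaAlgebra p) X.X := Module.Finite.of_surjective r hsurj
  have htorX : Module.IsTorsion (IwasawaAlgebra p) X.X := fun y ↦ by
    obtain ⟨x, rfl⟩ := hsurj y
    obtain ⟨a, ha⟩ := @htor₀ x
    exact ⟨a, by rw [Submonoid.smul_def, ← map_smul, ← Submonoid.smul_def, ha, map_zero]⟩
  have hμsum := X2.DualRestrictionInvariants.muInvariant_eq_add_of_surjective p r htor₀ hsurj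
  have hμK : muInvariant p (LinearMap.ker r) = 0 := by
    have h := hμ; rw [hμsum] at h; omega
  have hμX : muInvariant p X.X = 0 := by
    have h := hμ; rw [hμsum] at h; omega
  -- the kernel
  haveI : Module.Finite (IwasawaAlgebra p) (LinearMap.ker r) := Iwasawa.moduleFinite_ker p r
  have hKt : Module.IsTorsion (IwasawaAlgebra p) (LinearMap.ker r) := Iwasawa.isTorsion_ker p r htor₀
  obtain ⟨hfin, hcork⟩ :=
    X2.NonPrimitiveSelmerCorank.finite_torsionBy_and_zpCorank_eq_lambdaInvariant p (LinearMap.ker r)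
      hKt hμK (fun q ↦ isPrimary_quotient κ vbar htor (S₁ := S₁) (S₂ := S₂) q) Ψ
  refine ⟨hfg, htorX, hμX, hfin, ?_⟩
  rw [X2.DualRestrictionInvariants.lambdaInvariant_eq_add_of_surjective p r htor₀ hsurj, hcork, add_comm]

end Summit.BirchSwinnertonDyer.BirchSwinnertonDyer.Theorems.GrSelmerImprimitiveLambdaShift

end
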